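import Summits.PneNP.PneNP.Theses.ConvexRankGates
import Summits.PneNP.PneNP.Theorems.CliqueExtLowerBound.Negative.LoadBearing
import Summits.PneNP.PneNP.Theorems.ConvexRankGatesCliqueExtLowerBoundCnfSide
import Summits.PneNP.PneNP.Theorems.ConvexRankGatesCliqueExtLowerBoundHornsLeaves
import Summits.PneNP.PneNP.Theorems.ConvexRankGatesCliqueExtLowerBoundHornsLeavesConv
import Summits.PneNP.PneNP.Theorems.ConvexRankGatesCliqueExtLowerBoundRealGateLowerBound
import Summits.PneNP.PneNP.Theorems.ConvexRankGatesCliqueExtLowerBoundGRankFiniteField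
import Summits.PneNP.PneNP.Theorems.ConvexRankGatesCliqueExtLowerBoundGRankPrimeField
import Summits.PneNP.PneNP.Theorems.ConvexRankGatesCliqueExtLowerBoundGRankPrimeFieldLeaf
import Summits.PneNP.PneNP.Theorems.ConvexRankGatesCliqueExtLowerBoundShortCnf
import Summits.PneNP.PneNP.Theorems.ConvexRankGatesCliqueExtLowerBoundShortMaxtermsCore
import Summits.PneNP.PneNP.Theorems.ConvexRankGatesCliqueExtLowerBoundShortMaxtermsIdle
import Summits.PneNP.PneNP.Theorems.ConvexRankGatesCliqueExtLowerBoundAndPad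
import Summits.PneNP.PneNP.Theorems.ConvexRankGatesCliqueExtLowerBoundPermAndPad
import Summits.PneNP.PneNP.Theorems.ConvexRankGatesCliqueExtLowerBoundGRankAndPad
import Summits.PneNP.PneNP.Theorems.ConvexRankGatesCliqueExtLowerBoundConvPad
import Summits.PneNP.PneNP.Theorems.ConvexRankGatesCliqueExtLowerBoundPermPadLeaf
import Summits.PneNP.PneNP.Theorems.ConvexRankGatesCliqueExtLowerBoundGRankPadLeaf
import Summits.PneNP.PneNP.Theorems.ConvexRankGatesCliqueExtLowerBoundCnfSideR8
import Summits.PneNP.PneNP.Theorems.ConvexRankGatesCliqueExtLowerBoundGRankPrimeFieldLeafAll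
import Summits.PneNP.PneNP.Theorems.ConvexRankGatesCliqueExtLowerBoundUnitCnfPos
import Summits.PneNP.PneNP.Theorems.ConvexRankGatesCliqueExtLowerBoundUnitCnfNeg
import Summits.PneNP.PneNP.Theorems.ConvexRankGatesCliqueExtLowerBoundUnitCnfPermGate
import Summits.PneNP.PneNP.Theorems.ConvexRankGatesCliqueExtLowerBoundUnitCnfGRankGate
import Summits.PneNP.PneNP.Theorems.ConvexRankGatesCliqueExtLowerBoundUnitCnfConvGate
import Summits.PneNP.PneNP.Theorems.ConvexRankGatesCliqueExtLowerBoundLocalityMustGrow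
import Literature.Computability.Complexity.MonotoneRealLeafPairs

/-!
# Line `width-threshold-certificate-sparsity` — skeleton for the crux `ConvexRankGates.CliqueExtLowerBound`
(crux item stmt-PneNP-10682, rank 5 of route PneNP/ConvexRankGates) — LEAD VERSION r8 (continuation lead c12, 2026-08-17;
kept by continuation lead c13, 2026-08-17: re-verified at HEAD — rc 0, sorries 3, `CliqueExtLowerBound_of` closes the crux BY
NAME; §1f now IMPORTS the landed concrete `𝔽̄_p` form of the r8 GRANK leaf, `grankCnfAll_iff_primeFieldLeafAll` p159564, so every
landed sub-goal of §1b–§1f is referenced by a checked term; the three open leaves are UNCHANGED — each is ≥ a named open problem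
by the landed calibrations p114835 / p115659 / p121086 and the crux-level certificate p125807, see the lead NOTES `## Census`;
§1g NEW and LANDED: `LocalityMustGrow` — the `∀ c, ∃ r₀ s₀` order of the leaves is load-bearing, `r₀(c) > C(⌈4(c+1)/3⌉-1, 2)`,
uniform locality false for each class: p163210, p163376, p163060, p163140, p162996, p163743)

RESHAPE r8 (lead c12): WIDENESS IS FREE — the side conditions of the r7 leaves are idle. Padding a gate `φ` with an
`∧` of `L+1` dummy wires fed by the constant-true CNF (`L = ⌊m^{1/16}⌋₊(log₂⌊m^{1/16}⌋₊+1)`, the landed minterm bound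
of narrow PERM/GRANK gates) gives a gate of the same class at level `c+1`, NOT narrow, with the same composed function;
padding a CONV presentation with trivially feasible rows and an unconstrained psd block makes it "wide" at level `c+1`.
So `leaf_r7 (c+1) ⇒ leaf_r8 c` for each class (registered sub-goals `permCnfAll_of_permCnf`, `grankCnfAll_of_grankCnf`,
`convCnfAll_of_convWideCnf` of §1d, wave 2) and trivially `leaf_r8 ⇒ leaf_r7` (§2 `permCnf_of_permCnfAll` etc., proved):
EQUAL STRENGTH. The r8 leaves read, with no side condition at all: EVERY PERM / GRANK / CONV gate of size parameter
`≤ m^c`, composed with `s`-local monotone CNFs of the edges (`≤ m^{c+3}` distinct), admits a legal `(r,s)`-local sandwich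
on the referee pair. c12 also landed the negative-side companions of `sandwichable_of_shortDNF` (§1c): the dual engine
`sandwichable_of_shortCNF` (p154412), the vertex-core dichotomy `shortMaxterms_core` (p154713) and "short rejection
certificates are idle" `eventually_rej_blocking_le` (p155790) — a counterexample to any leaf needs LONG certificates on
BOTH sides (accepted cliques only through minterms of `> L` edges; rejected negatives, up to the horn slack, only through
maxterms of unbounded size).

(r7 header, lead c9, kept:) LEAD VERSION r7 (continuation lead c9, 2026-08-17;
kept unchanged by lead c10, who landed the HORN BRACKETS of the three stubs, see the paragraph `c10` below and §2;
kept unchanged by lead c11, who landed the GRANK FIELD NORMAL FORMS of §1b — every GRANK gate is a GRANK gate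
over a finite field, indeed over `AlgebraicClosure (ZMod p)` for some prime `p`, p148191 / p148712 — and the
equivalence of `stub_grankCnf` with its concrete `𝔽̄_p` form, p149952; the three open leaves are UNCHANGED)

STATE INHERITED (r6, leads c2–c8). `CliqueExtLowerBound_of` proved the crux BY NAME modulo three registered stubs
`stub_permSandwichable` (wide PERM gates; calibration p114835), `stub_grankSandwichable` (wide GRANK gates;
Valiant-hard, p115659) and `stub_convWide` (CONV gates with `> ⌊m^{1/16}⌋₊` rows and psd dimension `> c+1`;
Oliveira–Pudlák / Hrubeš OP3 regime, p121086); everything else landed (engine p77958/p78140, referee p80267,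
inline p81583, narrow algebraic p81373, reduction p109122, real-gate engine p120197/p119986/p120019/p120293/
p120473/p119146/p120634; bridge `ConvCalibrationR6.cliqueExtLowerBound_of_three_r6`). Crux-level certificate
(p125807): `Barrier.requires_doors`, `Barrier.requires_dc_lowerBound` — any proof of the crux proves cruxes #2/#4
and a superpolynomial determinantal-complexity lower bound for the clique polynomials over every field; so each
stub is ≥ a named open problem and the line cannot close before stmt-PneNP-10681 / stmt-PneNP-10680 do.

RESHAPE r7 (this lead): THE DNF SIDE IS IDLE. `Sandwichable` charges positives against `φ ∘ dval D` and negatives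
against `φ ∘ cval C` for legal children `D ≤ C`; every gate of `B_s` is monotone, so `φ (dval D x) ≤ φ (cval C x)`
and a legal local pair sandwiching the SINGLE function `φ ∘ cval C` on both sides sandwiches the pair
(`CnfSide.sandwichable_of_cnfSide`, landed). The three stubs are therefore restated CNF-SIDE-ONLY — one tuple
`C` of `s`-local monotone CNFs of the edges, two hypotheses fewer, the wide gate composed with a depth-2 monotone
formula on both sides — and `CnfSide.cliqueExtLowerBound_of_three_r7` (landed) proves the crux from them BY NAME.
Each r7 text implies its r6 predecessor verbatim (`CnfSide.permPairText_of_cnfText` etc., landed), hence inherits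
its calibration unchanged; conversely r6 ⇒ r7 costs one switching error per distinct child (not needed, not proved).
What this reshape is for: the prepared route split (Cruxes/…/SPLIT-PROPOSAL.md, strategist p1, not yet applied)
can file the children in this cleaner form; a refuter attacks ONE gate composed with local CNFs, no pair interface.

CHILDREN-FREE leaves (census §D3: absorb the CNF children into the gate class — CONV via an auxiliary diagonal
psd block `u_j ≤ Σ_{e∈S} x_e (S ∈ C j)`, `u_j ≤ 1`; GRANK via sums of fresh indeterminates for `∨` and a Schur /
path gadget for `∧`) were analysed and NOT adopted in r7: both absorptions are exact but the absorbed width is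
`width + O(#wires · #clauses)`, and an `s`-local CNF over the `≈ m²/2` edges may have `m^{2(s-1)}` clauses, so the
raw gate has width `m^{O(c+s)}` with `s` chosen AFTER the thresholds `r₀(c), s₀(c)`. A raw-gate leaf of the shape
`∀ a c, ∃ r₀ s₀, …` (thresholds depending on the width exponent `a`, as in the landed `stub_inline : ∀ a c, ∃ r₀ s₀`)
therefore does NOT imply the r7 leaf; one of the shape `∀ c, ∃ r₀ s₀, ∀ a, …` does, but is a strictly bolder
conjecture; the honest repair is a clause-budgeted currency (the engine's own CNFs have `O_{r,s}(1) · m^c` clauses,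
which the landed reduction does not export). Recorded in the lead's NOTES for the planner: D3 is a currency
change, not a typing triviality.

c10 (2026-08-17): THE STUBS ARE ONE-SIDED BLINDNESS STATEMENTS. The dual horn of a legal pair (`Horns.dual_dichotomy`:
a monomial `R₀ ∈ dnf` charges every rejected negative with `R₀` entirely on to the negative error) gives on the referee
pair `Horns.horns_of_pair`: sandwichable ⇒ accepts `≤ ε·#P` positives OR rejects `≤ (ε + (r-1)/⌊m^{1/8}⌋₊)·#N`
negatives; with the cheap exits, each stub below is BRACKETED (landed `HornsLeaves*`):
  blind at `(ε | ε)` ⇒ stub ⇒ blind at `(ε | ε + (r-1)/⌊m^{1/8}⌋₊)`, `ε = 1/(8m^{c+1})`.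
So a counterexample to a stub is exactly ONE gate of its class, reading `s`-local monotone CNFs of the edges, that
WEAKLY SEPARATES the pair (accepts `> ε·#P` bare cliques AND rejects `> (ε + (r-1)/⌊m^{1/8}⌋₊)·#N` dense negatives):
planted-clique detection at `k = m^{1/4}` in `K_m − G(m, m^{-1/8})` by one monotone wide gate. The stubs stay in the r7
form (window gates show the brackets are not an equivalence). Sub-classes landed by the c10 wave (all via the horn
form): gates accepting every diameter-2 graph (`DiamTwo`, incl. the nonabelian vertex-transposition PERM gates), gates
accepting every graph without a coclique on `≥ c+19` vertices (`CocliqueFree`), Tutte/Edmonds matching GRANK gates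
(`MatchingGates`), the CONV separation fact `ConvRowCone.convGate_reject_lt_accept` and row-dominated / degree-profile
SDP gates (`ConvRowCone`, `ConvDegreeProfile`).

Disproof.lean (gen 3) / Negative lemmas honoured as in r6 (width `≤ m^c` kept in every stub; the anchored theta
witness of `Negative.stub_convReplaceable_false` is sandwichable, consistent with `stub_convWideCnf`).
-/

set_option linter.dupNamespace false

open Literature.Computability.Complexity Filter Finset
open Summit.PneNP.PneNP.Theorems.CliqueExtLowerBound.Negative (LowerBoundAt cliqueExtLowerBound_iff)
open Summit.PneNP.PneNP.Theorems.CliqueExtLowerBound.WidthThreshold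

noncomputable section

namespace Summit.PneNP.PneNP.Cruxes.CliqueExtLowerBound.WidthThresholdCertificateSparsity

/-! ## §1 The registered stubs of r8: three OPEN (sorries only there), CNF-side-only, NO side conditions -/

open Classical in
/-- STUB `stub_permCnfAll` (open; r8 = r7's `stub_permCnf` with the idle clause "not narrow" removed): EVERY PERM gate —
permutation-group membership on `≤ m^c` points — composed with `s`-local monotone CNFs of the edges (`≤ m^{c+3}` distinct
ones) admits a legal `(r,s)`-local pair `dnf ≤ cnf` losing `≤ 1/(8m^{c+1})` of the bare `⌈m^{1/4}⌉₊`-cliques it accepts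
and accepting `≤ 1/(8m^{c+1})` of the dense negatives it rejects, once `r ≥ r₀(c)`, `s ≥ s₀(c)`. Equal in strength to
r7's `stub_permCnf` (§1d/§2); calibration p114835 (⇒ no poly-dimension permutation-group program for CLIQUE(m,⌈m^{1/4}⌉)). -/
theorem stub_permCnfAll : ∀ c : ℕ, ∃ r₀ s₀ : ℕ, 2 ≤ r₀ ∧ 2 ≤ s₀ ∧ ∀ r s : ℕ, r₀ ≤ r → s₀ ≤ s →
    ∀ᶠ m : ℕ in atTop, ∀ φ : GateFn, IsPermGate (m ^ c) φ →
      ∀ C : Fin φ.1 → Finset (Finset ((⊤ : SimpleGraph (Fin m)).edgeSet)),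
        #(univ.image C) ≤ m ^ (c + 3) → (∀ j, ∀ S ∈ C j, #S ≤ s - 1) →
        ∃ dnf cnf : Finset (Finset ((⊤ : SimpleGraph (Fin m)).edgeSet)),
          (∀ R ∈ dnf, #R ≤ r - 1) ∧ (∀ S ∈ cnf, #S ≤ s - 1) ∧
          (∀ x, EvalDNF dnf x → EvalCNF cnf x) ∧
          (#((posGraphs m ⌈(m : ℝ) ^ (1 / 4 : ℝ)⌉₊).filter
              (fun x => φ.2 (fun j => decide (EvalCNF (C j) x)) = true ∧ ¬ EvalDNF dnf x)) : ℝ)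
            ≤ (1 / (8 * (m : ℝ) ^ (c + 1))) * #(posGraphs m ⌈(m : ℝ) ^ (1 / 4 : ℝ)⌉₊) ∧
          (#((((powersetCard (Fintype.card ((⊤ : SimpleGraph (Fin m)).edgeSet) / ⌊(m : ℝ) ^ (1 / 8 : ℝ)⌋₊)
          (univ : Finset ((⊤ : SimpleGraph (Fin m)).edgeSet))).image (fun M => fun e => decide (e ∉ M)))).filter
              (fun x => EvalCNF cnf x ∧ φ.2 (fun j => decide (EvalCNF (C j) x)) = false)) : ℝ)
            ≤ (1 / (8 * (m : ℝ) ^ (c + 1))) *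
              #(((powersetCard (Fintype.card ((⊤ : SimpleGraph (Fin m)).edgeSet) / ⌊(m : ℝ) ^ (1 / 8 : ℝ)⌋₊)
          (univ : Finset ((⊤ : SimpleGraph (Fin m)).edgeSet))).image (fun M => fun e => decide (e ∉ M)))) := by
  sorry

open Classical in
/-- STUB `stub_grankCnfAll` (open; r8 = r7's `stub_grankCnf` without the "not narrow" clause): the same for EVERY GRANK
gate — generic-rank threshold of dimension `≤ m^c` over any field (WLOG over `AlgebraicClosure (ZMod p)`, §1b).
CONJECTURE-GRADE: ≥ Valiant's hypothesis by p115659. -/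
theorem stub_grankCnfAll : ∀ c : ℕ, ∃ r₀ s₀ : ℕ, 2 ≤ r₀ ∧ 2 ≤ s₀ ∧ ∀ r s : ℕ, r₀ ≤ r → s₀ ≤ s →
    ∀ᶠ m : ℕ in atTop, ∀ φ : GateFn, IsGRankGate (m ^ c) φ →
      ∀ C : Fin φ.1 → Finset (Finset ((⊤ : SimpleGraph (Fin m)).edgeSet)),
        #(univ.image C) ≤ m ^ (c + 3) → (∀ j, ∀ S ∈ C j, #S ≤ s - 1) →
        ∃ dnf cnf : Finset (Finset ((⊤ : SimpleGraph (Fin m)).edgeSet)),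
          (∀ R ∈ dnf, #R ≤ r - 1) ∧ (∀ S ∈ cnf, #S ≤ s - 1) ∧
          (∀ x, EvalDNF dnf x → EvalCNF cnf x) ∧
          (#((posGraphs m ⌈(m : ℝ) ^ (1 / 4 : ℝ)⌉₊).filter
              (fun x => φ.2 (fun j => decide (EvalCNF (C j) x)) = true ∧ ¬ EvalDNF dnf x)) : ℝ)
            ≤ (1 / (8 * (m : ℝ) ^ (c + 1))) * #(posGraphs m ⌈(m : ℝ) ^ (1 / 4 : ℝ)⌉₊) ∧
          (#((((powersetCard (Fintype.card ((⊤ : SimpleGraph (Fin m)).edgeSet) / ⌊(m : ℝ) ^ (1 / 8 : ℝ)⌋₊)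
          (univ : Finset ((⊤ : SimpleGraph (Fin m)).edgeSet))).image (fun M => fun e => decide (e ∉ M)))).filter
              (fun x => EvalCNF cnf x ∧ φ.2 (fun j => decide (EvalCNF (C j) x)) = false)) : ℝ)
            ≤ (1 / (8 * (m : ℝ) ^ (c + 1))) *
              #(((powersetCard (Fintype.card ((⊤ : SimpleGraph (Fin m)).edgeSet) / ⌊(m : ℝ) ^ (1 / 8 : ℝ)⌋₊)
          (univ : Finset ((⊤ : SimpleGraph (Fin m)).edgeSet))).image (fun M => fun e => decide (e ∉ M)))) := by
  sorry

open Classical in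
/-- STUB `stub_convCnfAll` (open, the lead's; r8 = r7's `stub_convWideCnf` with the presentation clause "more than
`⌊m^{1/16}⌋₊` rows and psd dimension `> c+1`" removed — idle by padding): the same for EVERY CONV gate of width
`p + q ≤ m^c` (`IsConvGate (m^c) φ`). = the single-gate content of crux #2; ⊇ Hrubeš OP3 (p121086). -/
theorem stub_convCnfAll : ∀ c : ℕ, ∃ r₀ s₀ : ℕ, 2 ≤ r₀ ∧ 2 ≤ s₀ ∧ ∀ r s : ℕ, r₀ ≤ r → s₀ ≤ s →
    ∀ᶠ m : ℕ in atTop, ∀ φ : GateFn, IsConvGate (m ^ c) φ →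
      ∀ C : Fin φ.1 → Finset (Finset ((⊤ : SimpleGraph (Fin m)).edgeSet)),
        #(univ.image C) ≤ m ^ (c + 3) → (∀ j, ∀ S ∈ C j, #S ≤ s - 1) →
        ∃ dnf cnf : Finset (Finset ((⊤ : SimpleGraph (Fin m)).edgeSet)),
          (∀ R ∈ dnf, #R ≤ r - 1) ∧ (∀ S ∈ cnf, #S ≤ s - 1) ∧
          (∀ x, EvalDNF dnf x → EvalCNF cnf x) ∧
          (#((posGraphs m ⌈(m : ℝ) ^ (1 / 4 : ℝ)⌉₊).filter
              (fun x => φ.2 (fun j => decide (EvalCNF (C j) x)) = true ∧ ¬ EvalDNF dnf x)) : ℝ)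
            ≤ (1 / (8 * (m : ℝ) ^ (c + 1))) * #(posGraphs m ⌈(m : ℝ) ^ (1 / 4 : ℝ)⌉₊) ∧
          (#((((powersetCard (Fintype.card ((⊤ : SimpleGraph (Fin m)).edgeSet) / ⌊(m : ℝ) ^ (1 / 8 : ℝ)⌋₊)
          (univ : Finset ((⊤ : SimpleGraph (Fin m)).edgeSet))).image (fun M => fun e => decide (e ∉ M)))).filter
              (fun x => EvalCNF cnf x ∧ φ.2 (fun j => decide (EvalCNF (C j) x)) = false)) : ℝ)
            ≤ (1 / (8 * (m : ℝ) ^ (c + 1))) *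
              #(((powersetCard (Fintype.card ((⊤ : SimpleGraph (Fin m)).edgeSet) / ⌊(m : ℝ) ^ (1 / 8 : ℝ)⌋₊)
          (univ : Finset ((⊤ : SimpleGraph (Fin m)).edgeSet))).image (fun M => fun e => decide (e ∉ M)))) := by
  sorry

/-! ## §1b Registered sub-goal of lead c11 (structural fact about the basis; to be landed `--supports`) -/

/-- REGISTERED SUB-GOAL `grankGate_iff_finiteField` (lead c11; provable, proof in the lead's
`work/GRankFiniteField.lean`): the GRANK disjunct of the crux basis may be read over FINITE fields — every GRANK
gate over an arbitrary field `F : Type` is a GRANK gate, with the same dimension and threshold, over a finite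
field (reduce the finitely generated coefficient ring modulo a maximal ideal avoiding the non-vanishing minor
coefficients; `ℤ` is Jacobson). Wild field constants buy nothing but field size. -/
theorem grankGate_iff_finiteField : ∀ (s : ℕ) (g : GateFn), IsGRankGate s g ↔
    ∃ (F : Type) (_ : Field F) (_ : Finite F) (d θ : ℕ), d ≤ s ∧
      ∃ (K₀ : Matrix (Fin d) (Fin d) F) (K : Fin g.1 → Matrix (Fin d) (Fin d) F),
        ∀ v : Fin g.1 → Bool, g.2 v = true ↔ θ ≤ (symbolicMatrix K₀ K v).rank :=
  Summit.PneNP.PneNP.Theorems.CliqueExtLowerBound.GRankFiniteField.grankGate_iff_finiteField  -- LANDED p148191 (c11)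

/-- REGISTERED SUB-GOAL `grankGate_iff_algClosureZMod` (lead c11; provable, proof in the lead's
`work/GRankPrimeField.lean`): the sharper normal form — every GRANK gate is a GRANK gate over the algebraic
closure of `ZMod p` for some prime `p` (finite-field reduction, then base change along an `𝔽_p`-embedding into
`𝔽̄_p`); the type-valued quantifier `∃ (F : Type) [Field F]` of the basis collapses to `∃ p prime`, and
characteristic `0` is never needed. -/
theorem grankGate_iff_algClosureZMod : ∀ (s : ℕ) (g : GateFn), IsGRankGate s g ↔
    ∃ (p : ℕ) (_ : Fact p.Prime) (d θ : ℕ), d ≤ s ∧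
      ∃ (K₀ : Matrix (Fin d) (Fin d) (AlgebraicClosure (ZMod p)))
        (K : Fin g.1 → Matrix (Fin d) (Fin d) (AlgebraicClosure (ZMod p))),
        ∀ v : Fin g.1 → Bool, g.2 v = true ↔ θ ≤ (symbolicMatrix K₀ K v).rank :=
  Summit.PneNP.PneNP.Theorems.CliqueExtLowerBound.GRankPrimeField.grankGate_iff_algClosureZMod  -- LANDED p148712 (c11)

open Classical in
/-- REGISTERED SUB-GOAL `grankCnf_iff_primeFieldLeaf` (lead c11; provable, proof in the lead's
`work/GRankPrimeFieldLeaf.lean`): the GRANK leaf `stub_grankCnf` is EQUIVALENT to its concrete `𝔽̄_p` form — the same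
local-sandwich conclusion for the explicit rank-threshold gate of every matrix pencil `K₀ + ∑ Xᵢ Kᵢ` over
`AlgebraicClosure (ZMod p)`, `p` prime, `d ≤ m^c`: no `∃ (F : Type)`, no abstract `φ`. The form in which a refuter picks
ONE prime and ONE pencil, and in which the GRANK child of the prepared split may be filed. -/
theorem grankCnf_iff_primeFieldLeaf :
    (∀ c : ℕ, ∃ r₀ s₀ : ℕ, 2 ≤ r₀ ∧ 2 ≤ s₀ ∧ ∀ r s : ℕ, r₀ ≤ r → s₀ ≤ s →
    ∀ᶠ m : ℕ in atTop, ∀ φ : GateFn, IsGRankGate (m ^ c) φ →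
      ¬ (IsPermGate ⌊(m : ℝ) ^ (1 / 16 : ℝ)⌋₊ φ ∨ IsGRankGate ⌊(m : ℝ) ^ (1 / 16 : ℝ)⌋₊ φ) →
      ∀ C : Fin φ.1 → Finset (Finset ((⊤ : SimpleGraph (Fin m)).edgeSet)),
        #(univ.image C) ≤ m ^ (c + 3) → (∀ j, ∀ S ∈ C j, #S ≤ s - 1) →
        ∃ dnf cnf : Finset (Finset ((⊤ : SimpleGraph (Fin m)).edgeSet)),
          (∀ R ∈ dnf, #R ≤ r - 1) ∧ (∀ S ∈ cnf, #S ≤ s - 1) ∧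
          (∀ x, EvalDNF dnf x → EvalCNF cnf x) ∧
          (#((posGraphs m ⌈(m : ℝ) ^ (1 / 4 : ℝ)⌉₊).filter
              (fun x => φ.2 (fun j => decide (EvalCNF (C j) x)) = true ∧ ¬ EvalDNF dnf x)) : ℝ)
            ≤ (1 / (8 * (m : ℝ) ^ (c + 1))) * #(posGraphs m ⌈(m : ℝ) ^ (1 / 4 : ℝ)⌉₊) ∧
          (#((((powersetCard (Fintype.card ((⊤ : SimpleGraph (Fin m)).edgeSet) / ⌊(m : ℝ) ^ (1 / 8 : ℝ)⌋₊)
          (univ : Finset ((⊤ : SimpleGraph (Fin m)).edgeSet))).image (fun M => fun e => decide (e ∉ M)))).filter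
              (fun x => EvalCNF cnf x ∧ φ.2 (fun j => decide (EvalCNF (C j) x)) = false)) : ℝ)
            ≤ (1 / (8 * (m : ℝ) ^ (c + 1))) *
              #(((powersetCard (Fintype.card ((⊤ : SimpleGraph (Fin m)).edgeSet) / ⌊(m : ℝ) ^ (1 / 8 : ℝ)⌋₊)
          (univ : Finset ((⊤ : SimpleGraph (Fin m)).edgeSet))).image (fun M => fun e => decide (e ∉ M))))) ↔
    (∀ c : ℕ, ∃ r₀ s₀ : ℕ, 2 ≤ r₀ ∧ 2 ≤ s₀ ∧ ∀ r s : ℕ, r₀ ≤ r → s₀ ≤ s →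
    ∀ᶠ m : ℕ in atTop, ∀ (p : ℕ) (_ : Fact p.Prime) (n d θ : ℕ), d ≤ m ^ c →
      ∀ (K₀ : Matrix (Fin d) (Fin d) (AlgebraicClosure (ZMod p)))
        (K : Fin n → Matrix (Fin d) (Fin d) (AlgebraicClosure (ZMod p))),
      ¬ (IsPermGate ⌊(m : ℝ) ^ (1 / 16 : ℝ)⌋₊ ⟨n, fun v => decide (θ ≤ (symbolicMatrix K₀ K v).rank)⟩ ∨
          IsGRankGate ⌊(m : ℝ) ^ (1 / 16 : ℝ)⌋₊ ⟨n, fun v => decide (θ ≤ (symbolicMatrix K₀ K v).rank)⟩) →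
      ∀ C : Fin n → Finset (Finset ((⊤ : SimpleGraph (Fin m)).edgeSet)),
        #(univ.image C) ≤ m ^ (c + 3) → (∀ j, ∀ S ∈ C j, #S ≤ s - 1) →
        ∃ dnf cnf : Finset (Finset ((⊤ : SimpleGraph (Fin m)).edgeSet)),
          (∀ R ∈ dnf, #R ≤ r - 1) ∧ (∀ S ∈ cnf, #S ≤ s - 1) ∧
          (∀ x, EvalDNF dnf x → EvalCNF cnf x) ∧
          (#((posGraphs m ⌈(m : ℝ) ^ (1 / 4 : ℝ)⌉₊).filter
              (fun x => decide (θ ≤ (symbolicMatrix K₀ K (fun j => decide (EvalCNF (C j) x))).rank) = true ∧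
                ¬ EvalDNF dnf x)) : ℝ)
            ≤ (1 / (8 * (m : ℝ) ^ (c + 1))) * #(posGraphs m ⌈(m : ℝ) ^ (1 / 4 : ℝ)⌉₊) ∧
          (#((((powersetCard (Fintype.card ((⊤ : SimpleGraph (Fin m)).edgeSet) / ⌊(m : ℝ) ^ (1 / 8 : ℝ)⌋₊)
          (univ : Finset ((⊤ : SimpleGraph (Fin m)).edgeSet))).image (fun M => fun e => decide (e ∉ M)))).filter
              (fun x => EvalCNF cnf x ∧
                decide (θ ≤ (symbolicMatrix K₀ K (fun j => decide (EvalCNF (C j) x))).rank) = false)) : ℝ)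
            ≤ (1 / (8 * (m : ℝ) ^ (c + 1))) *
              #(((powersetCard (Fintype.card ((⊤ : SimpleGraph (Fin m)).edgeSet) / ⌊(m : ℝ) ^ (1 / 8 : ℝ)⌋₊)
          (univ : Finset ((⊤ : SimpleGraph (Fin m)).edgeSet))).image (fun M => fun e => decide (e ∉ M))))) :=
  Summit.PneNP.PneNP.Theorems.CliqueExtLowerBound.GRankPrimeFieldLeaf.grankCnf_iff_primeFieldLeaf  -- LANDED p149952 (c11)

/-! ## §1c Registered sub-goals of lead c12 (structural, provable; to be landed `--supports`)

"A counterexample to any leaf needs LONG certificates on BOTH sides." The positive side is the landed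
`SandwichEffectiveWidth.sandwichable_of_shortDNF` (a short-DNF minorant covering the accepted positives sandwiches the
gate). The two sub-goals below are its negative-side companions. -/

open Classical in
/-- REGISTERED SUB-GOAL `sandwichable_of_shortCNF` (lead c12; the DUAL ENGINE; LANDED p154412, `Theorems/…ShortCnf.lean`). For every `c` and every constant clause
width `w` there are `r₀ s₀` such that for `r ≥ r₀`, `s ≥ s₀` and all large `m`: ANY Boolean function `g` of the edge
slots admits the legal local sandwich of the r7 leaves as soon as some CNF `B₀` with clauses of `≤ w` edges
(i) holds on every positive accepted by `g` and (ii) holds on at most `#N/(16 m^{c+1})` of the negatives rejected by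
`g` — i.e. as soon as all but a negligible part of the rejections of `g` are certified by maxterms of bounded size.
Proof template = `sandwichable_of_shortDNF` read backwards: switch `B₀` DOWN to an `(r-1)`-DNF `A` (`≤ w^r` exceptional
exact `r`-monomials, each on `≤ (k/m)^{4(c+3)} #P` positives, `card_filter_pos_mul_pow_le` / `pos_numerics`), then `A`
UP to an `(s-1)`-CNF `B` (`≤ (r-1)^s` exceptional exact `s`-clauses, each failing on `≤ ⌊m^{1/8}⌋₊^{-s} #N` negatives,
`card_filter_neg_mul_pow_le` / `eventually_neg_numerics`); output `(A, B)`. [cite: Jukna2012, Lemma 9.15] -/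
theorem sandwichable_of_shortCNF : ∀ c w : ℕ, ∃ r₀ s₀ : ℕ, 2 ≤ r₀ ∧ 2 ≤ s₀ ∧ ∀ r s : ℕ, r₀ ≤ r → s₀ ≤ s →
    ∀ᶠ m : ℕ in atTop, ∀ (g : (((⊤ : SimpleGraph (Fin m)).edgeSet) → Bool) → Bool)
      (B₀ : Finset (Finset ((⊤ : SimpleGraph (Fin m)).edgeSet))),
      (∀ S ∈ B₀, #S ≤ w) →
      (∀ x ∈ posGraphs m ⌈(m : ℝ) ^ (1 / 4 : ℝ)⌉₊, g x = true → EvalCNF B₀ x) →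
      #((((powersetCard (Fintype.card ((⊤ : SimpleGraph (Fin m)).edgeSet) / ⌊(m : ℝ) ^ (1 / 8 : ℝ)⌋₊)
          (univ : Finset ((⊤ : SimpleGraph (Fin m)).edgeSet))).image (fun M => fun e => decide (e ∉ M)))).filter
          (fun x => EvalCNF B₀ x ∧ g x = false)) * (16 * m ^ (c + 1)) ≤
        #(((powersetCard (Fintype.card ((⊤ : SimpleGraph (Fin m)).edgeSet) / ⌊(m : ℝ) ^ (1 / 8 : ℝ)⌋₊)
          (univ : Finset ((⊤ : SimpleGraph (Fin m)).edgeSet))).image (fun M => fun e => decide (e ∉ M)))) →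
      ∃ dnf cnf : Finset (Finset ((⊤ : SimpleGraph (Fin m)).edgeSet)),
        (∀ R ∈ dnf, #R ≤ r - 1) ∧ (∀ S ∈ cnf, #S ≤ s - 1) ∧
        (∀ x, EvalDNF dnf x → EvalCNF cnf x) ∧
        (#((posGraphs m ⌈(m : ℝ) ^ (1 / 4 : ℝ)⌉₊).filter
            (fun x => g x = true ∧ ¬ EvalDNF dnf x)) : ℝ)
          ≤ (1 / (8 * (m : ℝ) ^ (c + 1))) * #(posGraphs m ⌈(m : ℝ) ^ (1 / 4 : ℝ)⌉₊) ∧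
        (#((((powersetCard (Fintype.card ((⊤ : SimpleGraph (Fin m)).edgeSet) / ⌊(m : ℝ) ^ (1 / 8 : ℝ)⌋₊)
        (univ : Finset ((⊤ : SimpleGraph (Fin m)).edgeSet))).image (fun M => fun e => decide (e ∉ M)))).filter
            (fun x => EvalCNF cnf x ∧ g x = false)) : ℝ)
          ≤ (1 / (8 * (m : ℝ) ^ (c + 1))) *
            #(((powersetCard (Fintype.card ((⊤ : SimpleGraph (Fin m)).edgeSet) / ⌊(m : ℝ) ^ (1 / 8 : ℝ)⌋₊)
        (univ : Finset ((⊤ : SimpleGraph (Fin m)).edgeSet))).image (fun M => fun e => decide (e ∉ M)))) :=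
  ShortCnf.sandwichable_of_shortCNF  -- LANDED p154412 (c12 wave 1)

/-- REGISTERED SUB-GOAL `shortMaxterms_core` (lead c12; the VERTEX-CORE DICHOTOMY, pure combinatorics, no asymptotics; LANDED p154713, `Theorems/…ShortMaxtermsCore.lean`).
For a family `𝓛` of nonempty edge sets of `K_m` each with `≤ w` edges and a budget `q`: EITHER there is a vertex set `W`
of size `≤ 4 w² q` such that every member of `𝓛` has an edge INSIDE `W`, OR few `k`-cliques meet every member of `𝓛`
(at most `(2w)^q · C(m-q, k-q)` of the `C(m,k)` clique vectors). Proof: `2w` rounds; in round `j` take a maximal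
subfamily of the members without an edge inside the current `W` whose vertex sets outside `W` are pairwise disjoint — if
it has `≥ q` members every clique meeting all of `𝓛` contains a vertex of each of `q` disjoint sets of `≤ 2w` vertices
(second alternative), else add their outside vertices to `W`; a member surviving `j` rounds has `≥ j+1` vertices in `W`,
so none survives `2w` rounds. Use (lead, next file): a rejected dense negative whose rejection is certified by a maxterm
of size `≤ w` misses an edge inside `W`, which happens for `≤ C(#W,2)/⌊m^{1/8}⌋₊` of the negatives
(`Horns.card_filter_not_satTerm_mul_div_le`) — rejection through bounded maxterms is idle up to the horn slack once the
gate accepts more than `(2w)^q C(m-q,k-q)` bare cliques. [folklore] -/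
theorem shortMaxterms_core : ∀ (m k w q : ℕ) (𝓛 : Finset (Finset ((⊤ : SimpleGraph (Fin m)).edgeSet))),
    (∀ L ∈ 𝓛, L.Nonempty ∧ #L ≤ w) →
    (∃ W : Finset (Fin m), #W ≤ 4 * w ^ 2 * q ∧
        ∀ L ∈ 𝓛, ∃ e ∈ L, ∀ v ∈ (e : Sym2 (Fin m)), v ∈ W) ∨
    #((posGraphs m k).filter fun x => ∀ L ∈ 𝓛, ∃ e ∈ L, x e = true) ≤ (2 * w) ^ q * (m - q).choose (k - q) :=
  ShortMaxtermsCore.shortMaxterms_core  -- LANDED p154713 (c12 wave 1)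

open Classical in
/-- REGISTERED SUB-GOAL `eventually_rej_blocking_le` (lead c12; SHORT CERTIFICATES ARE IDLE — the use of
`shortMaxterms_core`; LANDED p155790, `Theorems/…ShortMaxtermsIdle.lean`). For every `c, w`, for all large `m`:
if a Boolean function `g` of the edge slots accepts more than `#P/(8m^{c+1})` bare `⌈m^{1/4}⌉₊`-cliques, then
for every family `𝓛` of blocking sets of `g` (nonempty, `≤ w` edges each; all edges of a member off forces
rejection — e.g. maxterms of a monotone `g`) the negatives rejected THROUGH a member of `𝓛` are at most
`C(16w²(c+3)+1, 2)/⌊m^{1/8}⌋₊` of all negatives: inside the horn slack `(r-1)/⌊m^{1/8}⌋₊` of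
`Horns.horns_of_pair`, hence idle. A counterexample to a leaf owes all but `O_{c,w}(1)/⌊m^{1/8}⌋₊` of its
rejections to minimal rejection certificates of more than `w` edges, for every constant `w`. [folklore] -/
theorem eventually_rej_blocking_le : ∀ c w : ℕ, ∀ᶠ m : ℕ in atTop,
    ∀ (g : (((⊤ : SimpleGraph (Fin m)).edgeSet) → Bool) → Bool)
      (𝓛 : Finset (Finset ((⊤ : SimpleGraph (Fin m)).edgeSet))),
      (∀ L ∈ 𝓛, L.Nonempty ∧ #L ≤ w) →
      (∀ L ∈ 𝓛, ∀ y : ((⊤ : SimpleGraph (Fin m)).edgeSet) → Bool, (∀ e ∈ L, y e = false) → g y = false) →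
      #(posGraphs m ⌈(m : ℝ) ^ (1 / 4 : ℝ)⌉₊) <
        #((posGraphs m ⌈(m : ℝ) ^ (1 / 4 : ℝ)⌉₊).filter fun x => g x = true) * (8 * m ^ (c + 1)) →
      #((((powersetCard (Fintype.card ((⊤ : SimpleGraph (Fin m)).edgeSet) / ⌊(m : ℝ) ^ (1 / 8 : ℝ)⌋₊)
          (univ : Finset ((⊤ : SimpleGraph (Fin m)).edgeSet))).image (fun M => fun e => decide (e ∉ M)))).filter
          fun x => g x = false ∧ ∃ L ∈ 𝓛, ∀ e ∈ L, x e = false) * ⌊(m : ℝ) ^ (1 / 8 : ℝ)⌋₊ ≤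
        (4 * w ^ 2 * (4 * (c + 3)) + 1).choose 2 *
          #(((powersetCard (Fintype.card ((⊤ : SimpleGraph (Fin m)).edgeSet) / ⌊(m : ℝ) ^ (1 / 8 : ℝ)⌋₊)
            (univ : Finset ((⊤ : SimpleGraph (Fin m)).edgeSet))).image (fun M => fun e => decide (e ∉ M)))) :=
  ShortMaxtermsIdle.eventually_rej_blocking_le  -- LANDED p155790 (c12)

/-! ## §1d Registered sub-goals of lead c12, wave 2: WIDENESS IS FREE (r7 leaf at level `c+1` ⇒ r8 leaf at level `c`) -/

section WaveTwo

open Classical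


/-- REGISTERED SUB-GOAL `permCnfAll_of_permCnf` (lead c12, wave 2; provable): the r7 PERM leaf (all levels) implies the
r8 PERM leaf (all levels). Given a PERM gate `φ` on `d ≤ m^c` points and children `C`, pad: `φ' := φ ∧ (∧ of L+1 dummy
wires)`, realised on `d + 2(L+1) ≤ m^{c+1}` points (old generators ⊕ id, dummies id ⊕ disjoint transpositions, target
`τ ⊕ Π transpositions`; closure in a direct product is the product of the closures), children `C' := C` on old wires and
the EMPTY CNF (constant true) on the dummies; `φ'` is not narrow (every minterm contains the `L+1 > L` dummies, against the
landed minterm bound `NarrowAlgebraicHelpers.exists_minterm_of_perm_or_grank` / registered `narrowAlgebraic_shortMinterms`),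
`#(univ.image C') ≤ #(univ.image C) + 1 ≤ m^{(c+1)+3}`, and `φ'.2 (cval C' x) = φ.2 (cval C x)` for every `x`; apply the r7
leaf at level `c+1` (error `1/(8m^{c+2}) ≤ 1/(8m^{c+1})`). -/
theorem permCnfAll_of_permCnf :
    (∀ c : ℕ, ∃ r₀ s₀ : ℕ, 2 ≤ r₀ ∧ 2 ≤ s₀ ∧ ∀ r s : ℕ, r₀ ≤ r → s₀ ≤ s →
    ∀ᶠ m : ℕ in atTop, ∀ φ : GateFn, IsPermGate (m ^ c) φ →
      ¬ (IsPermGate ⌊(m : ℝ) ^ (1 / 16 : ℝ)⌋₊ φ ∨ IsGRankGate ⌊(m : ℝ) ^ (1 / 16 : ℝ)⌋₊ φ) →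
      ∀ C : Fin φ.1 → Finset (Finset ((⊤ : SimpleGraph (Fin m)).edgeSet)),
        #(univ.image C) ≤ m ^ (c + 3) → (∀ j, ∀ S ∈ C j, #S ≤ s - 1) →
        ∃ dnf cnf : Finset (Finset ((⊤ : SimpleGraph (Fin m)).edgeSet)),
          (∀ R ∈ dnf, #R ≤ r - 1) ∧ (∀ S ∈ cnf, #S ≤ s - 1) ∧
          (∀ x, EvalDNF dnf x → EvalCNF cnf x) ∧
          (#((posGraphs m ⌈(m : ℝ) ^ (1 / 4 : ℝ)⌉₊).filter
              (fun x => φ.2 (fun j => decide (EvalCNF (C j) x)) = true ∧ ¬ EvalDNF dnf x)) : ℝ)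
            ≤ (1 / (8 * (m : ℝ) ^ (c + 1))) * #(posGraphs m ⌈(m : ℝ) ^ (1 / 4 : ℝ)⌉₊) ∧
          (#((((powersetCard (Fintype.card ((⊤ : SimpleGraph (Fin m)).edgeSet) / ⌊(m : ℝ) ^ (1 / 8 : ℝ)⌋₊)
          (univ : Finset ((⊤ : SimpleGraph (Fin m)).edgeSet))).image (fun M => fun e => decide (e ∉ M)))).filter
              (fun x => EvalCNF cnf x ∧ φ.2 (fun j => decide (EvalCNF (C j) x)) = false)) : ℝ)
            ≤ (1 / (8 * (m : ℝ) ^ (c + 1))) *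
              #(((powersetCard (Fintype.card ((⊤ : SimpleGraph (Fin m)).edgeSet) / ⌊(m : ℝ) ^ (1 / 8 : ℝ)⌋₊)
          (univ : Finset ((⊤ : SimpleGraph (Fin m)).edgeSet))).image (fun M => fun e => decide (e ∉ M))))) →
    (∀ c : ℕ, ∃ r₀ s₀ : ℕ, 2 ≤ r₀ ∧ 2 ≤ s₀ ∧ ∀ r s : ℕ, r₀ ≤ r → s₀ ≤ s →
    ∀ᶠ m : ℕ in atTop, ∀ φ : GateFn, IsPermGate (m ^ c) φ →
      ∀ C : Fin φ.1 → Finset (Finset ((⊤ : SimpleGraph (Fin m)).edgeSet)),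
        #(univ.image C) ≤ m ^ (c + 3) → (∀ j, ∀ S ∈ C j, #S ≤ s - 1) →
        ∃ dnf cnf : Finset (Finset ((⊤ : SimpleGraph (Fin m)).edgeSet)),
          (∀ R ∈ dnf, #R ≤ r - 1) ∧ (∀ S ∈ cnf, #S ≤ s - 1) ∧
          (∀ x, EvalDNF dnf x → EvalCNF cnf x) ∧
          (#((posGraphs m ⌈(m : ℝ) ^ (1 / 4 : ℝ)⌉₊).filter
              (fun x => φ.2 (fun j => decide (EvalCNF (C j) x)) = true ∧ ¬ EvalDNF dnf x)) : ℝ)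
            ≤ (1 / (8 * (m : ℝ) ^ (c + 1))) * #(posGraphs m ⌈(m : ℝ) ^ (1 / 4 : ℝ)⌉₊) ∧
          (#((((powersetCard (Fintype.card ((⊤ : SimpleGraph (Fin m)).edgeSet) / ⌊(m : ℝ) ^ (1 / 8 : ℝ)⌋₊)
          (univ : Finset ((⊤ : SimpleGraph (Fin m)).edgeSet))).image (fun M => fun e => decide (e ∉ M)))).filter
              (fun x => EvalCNF cnf x ∧ φ.2 (fun j => decide (EvalCNF (C j) x)) = false)) : ℝ)
            ≤ (1 / (8 * (m : ℝ) ^ (c + 1))) *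
              #(((powersetCard (Fintype.card ((⊤ : SimpleGraph (Fin m)).edgeSet) / ⌊(m : ℝ) ^ (1 / 8 : ℝ)⌋₊)
          (univ : Finset ((⊤ : SimpleGraph (Fin m)).edgeSet))).image (fun M => fun e => decide (e ∉ M))))) :=
  PermPadLeaf.permCnfAll_of_permCnf  -- LANDED p158256 (c12 wave 3)

/-- REGISTERED SUB-GOAL `grankCnfAll_of_grankCnf` (lead c12, wave 2; provable): the same for GRANK. Pad the pencil
`(K₀, K, θ)` of dimension `d` to the block-diagonal pencil of dimension `d + (d+1)(L+1)` with `L+1` dummy wires, dummy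
`j` carrying `X_j · I_{d+1}` in its own block, threshold `θ' := θ + (d+1)(L+1)` (rank is additive over blocks; if a dummy
is off the total rank is `≤ d + (d+1)L < θ'`; if all are on, `rank ≥ θ'` iff `rank (old block) ≥ θ`); children as for
PERM; not narrow by the minterm bound; apply the r7 leaf at level `c+1`. -/
theorem grankCnfAll_of_grankCnf :
    (∀ c : ℕ, ∃ r₀ s₀ : ℕ, 2 ≤ r₀ ∧ 2 ≤ s₀ ∧ ∀ r s : ℕ, r₀ ≤ r → s₀ ≤ s →
    ∀ᶠ m : ℕ in atTop, ∀ φ : GateFn, IsGRankGate (m ^ c) φ →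
      ¬ (IsPermGate ⌊(m : ℝ) ^ (1 / 16 : ℝ)⌋₊ φ ∨ IsGRankGate ⌊(m : ℝ) ^ (1 / 16 : ℝ)⌋₊ φ) →
      ∀ C : Fin φ.1 → Finset (Finset ((⊤ : SimpleGraph (Fin m)).edgeSet)),
        #(univ.image C) ≤ m ^ (c + 3) → (∀ j, ∀ S ∈ C j, #S ≤ s - 1) →
        ∃ dnf cnf : Finset (Finset ((⊤ : SimpleGraph (Fin m)).edgeSet)),
          (∀ R ∈ dnf, #R ≤ r - 1) ∧ (∀ S ∈ cnf, #S ≤ s - 1) ∧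
          (∀ x, EvalDNF dnf x → EvalCNF cnf x) ∧
          (#((posGraphs m ⌈(m : ℝ) ^ (1 / 4 : ℝ)⌉₊).filter
              (fun x => φ.2 (fun j => decide (EvalCNF (C j) x)) = true ∧ ¬ EvalDNF dnf x)) : ℝ)
            ≤ (1 / (8 * (m : ℝ) ^ (c + 1))) * #(posGraphs m ⌈(m : ℝ) ^ (1 / 4 : ℝ)⌉₊) ∧
          (#((((powersetCard (Fintype.card ((⊤ : SimpleGraph (Fin m)).edgeSet) / ⌊(m : ℝ) ^ (1 / 8 : ℝ)⌋₊)
          (univ : Finset ((⊤ : SimpleGraph (Fin m)).edgeSet))).image (fun M => fun e => decide (e ∉ M)))).filter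
              (fun x => EvalCNF cnf x ∧ φ.2 (fun j => decide (EvalCNF (C j) x)) = false)) : ℝ)
            ≤ (1 / (8 * (m : ℝ) ^ (c + 1))) *
              #(((powersetCard (Fintype.card ((⊤ : SimpleGraph (Fin m)).edgeSet) / ⌊(m : ℝ) ^ (1 / 8 : ℝ)⌋₊)
          (univ : Finset ((⊤ : SimpleGraph (Fin m)).edgeSet))).image (fun M => fun e => decide (e ∉ M))))) →
    (∀ c : ℕ, ∃ r₀ s₀ : ℕ, 2 ≤ r₀ ∧ 2 ≤ s₀ ∧ ∀ r s : ℕ, r₀ ≤ r → s₀ ≤ s →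
    ∀ᶠ m : ℕ in atTop, ∀ φ : GateFn, IsGRankGate (m ^ c) φ →
      ∀ C : Fin φ.1 → Finset (Finset ((⊤ : SimpleGraph (Fin m)).edgeSet)),
        #(univ.image C) ≤ m ^ (c + 3) → (∀ j, ∀ S ∈ C j, #S ≤ s - 1) →
        ∃ dnf cnf : Finset (Finset ((⊤ : SimpleGraph (Fin m)).edgeSet)),
          (∀ R ∈ dnf, #R ≤ r - 1) ∧ (∀ S ∈ cnf, #S ≤ s - 1) ∧
          (∀ x, EvalDNF dnf x → EvalCNF cnf x) ∧
          (#((posGraphs m ⌈(m : ℝ) ^ (1 / 4 : ℝ)⌉₊).filter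
              (fun x => φ.2 (fun j => decide (EvalCNF (C j) x)) = true ∧ ¬ EvalDNF dnf x)) : ℝ)
            ≤ (1 / (8 * (m : ℝ) ^ (c + 1))) * #(posGraphs m ⌈(m : ℝ) ^ (1 / 4 : ℝ)⌉₊) ∧
          (#((((powersetCard (Fintype.card ((⊤ : SimpleGraph (Fin m)).edgeSet) / ⌊(m : ℝ) ^ (1 / 8 : ℝ)⌋₊)
          (univ : Finset ((⊤ : SimpleGraph (Fin m)).edgeSet))).image (fun M => fun e => decide (e ∉ M)))).filter
              (fun x => EvalCNF cnf x ∧ φ.2 (fun j => decide (EvalCNF (C j) x)) = false)) : ℝ)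
            ≤ (1 / (8 * (m : ℝ) ^ (c + 1))) *
              #(((powersetCard (Fintype.card ((⊤ : SimpleGraph (Fin m)).edgeSet) / ⌊(m : ℝ) ^ (1 / 8 : ℝ)⌋₊)
          (univ : Finset ((⊤ : SimpleGraph (Fin m)).edgeSet))).image (fun M => fun e => decide (e ∉ M))))) :=
  GRankPadLeaf.grankCnfAll_of_grankCnf  -- LANDED p158045 (c12 wave 3)

/-- REGISTERED SUB-GOAL `convCnfAll_of_convWideCnf` (lead c12, wave 2; provable, the easiest): the same for CONV. A
presentation `(p, q, A, b, B)` of width `p + q ≤ m^c` is padded to `p' := p + ⌊m^{1/16}⌋₊ + 1` rows (new rows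
`A_i := 0`, `b_i := 0`, `B_i := 0`: `0 ≤ 0`, always satisfied) and psd dimension `q' := q + c + 3` (`A_i` extended by a
zero block; a psd `Y'` restricts to a psd `Y`, a psd `Y` extends by zeros): same Boolean function, same `φ`, width
`≤ m^{c+1}` for large `m`, and the "wide" clause of the r7 leaf at level `c+1` holds (`⌊m^{1/16}⌋₊ < p'`,
`(c+1)+1 < q'`). -/
theorem convCnfAll_of_convWideCnf :
    (∀ c : ℕ, ∃ r₀ s₀ : ℕ, 2 ≤ r₀ ∧ 2 ≤ s₀ ∧ ∀ r s : ℕ, r₀ ≤ r → s₀ ≤ s →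
    ∀ᶠ m : ℕ in atTop, ∀ φ : GateFn,
      (∃ p q : ℕ, p + q ≤ m ^ c ∧ ⌊(m : ℝ) ^ (1 / 16 : ℝ)⌋₊ < p ∧ c + 1 < q ∧
        ∃ (A : Fin p → Matrix (Fin q) (Fin q) ℝ) (b : Fin p → ℝ)
        (B : Fin p → Fin φ.1 → ℝ), (∀ i j, 0 ≤ B i j) ∧ ∀ v : Fin φ.1 → Bool, φ.2 v = true ↔
          ∃ Y : Matrix (Fin q) (Fin q) ℝ, Y.PosSemidef ∧
            ∀ i, (A i * Y).trace ≤ b i + ∑ j, B i j * (if v j then (1 : ℝ) else 0)) →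
      ∀ C : Fin φ.1 → Finset (Finset ((⊤ : SimpleGraph (Fin m)).edgeSet)),
        #(univ.image C) ≤ m ^ (c + 3) → (∀ j, ∀ S ∈ C j, #S ≤ s - 1) →
        ∃ dnf cnf : Finset (Finset ((⊤ : SimpleGraph (Fin m)).edgeSet)),
          (∀ R ∈ dnf, #R ≤ r - 1) ∧ (∀ S ∈ cnf, #S ≤ s - 1) ∧
          (∀ x, EvalDNF dnf x → EvalCNF cnf x) ∧
          (#((posGraphs m ⌈(m : ℝ) ^ (1 / 4 : ℝ)⌉₊).filter
              (fun x => φ.2 (fun j => decide (EvalCNF (C j) x)) = true ∧ ¬ EvalDNF dnf x)) : ℝ)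
            ≤ (1 / (8 * (m : ℝ) ^ (c + 1))) * #(posGraphs m ⌈(m : ℝ) ^ (1 / 4 : ℝ)⌉₊) ∧
          (#((((powersetCard (Fintype.card ((⊤ : SimpleGraph (Fin m)).edgeSet) / ⌊(m : ℝ) ^ (1 / 8 : ℝ)⌋₊)
          (univ : Finset ((⊤ : SimpleGraph (Fin m)).edgeSet))).image (fun M => fun e => decide (e ∉ M)))).filter
              (fun x => EvalCNF cnf x ∧ φ.2 (fun j => decide (EvalCNF (C j) x)) = false)) : ℝ)
            ≤ (1 / (8 * (m : ℝ) ^ (c + 1))) *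
              #(((powersetCard (Fintype.card ((⊤ : SimpleGraph (Fin m)).edgeSet) / ⌊(m : ℝ) ^ (1 / 8 : ℝ)⌋₊)
          (univ : Finset ((⊤ : SimpleGraph (Fin m)).edgeSet))).image (fun M => fun e => decide (e ∉ M))))) →
    (∀ c : ℕ, ∃ r₀ s₀ : ℕ, 2 ≤ r₀ ∧ 2 ≤ s₀ ∧ ∀ r s : ℕ, r₀ ≤ r → s₀ ≤ s →
    ∀ᶠ m : ℕ in atTop, ∀ φ : GateFn, IsConvGate (m ^ c) φ →
      ∀ C : Fin φ.1 → Finset (Finset ((⊤ : SimpleGraph (Fin m)).edgeSet)),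
        #(univ.image C) ≤ m ^ (c + 3) → (∀ j, ∀ S ∈ C j, #S ≤ s - 1) →
        ∃ dnf cnf : Finset (Finset ((⊤ : SimpleGraph (Fin m)).edgeSet)),
          (∀ R ∈ dnf, #R ≤ r - 1) ∧ (∀ S ∈ cnf, #S ≤ s - 1) ∧
          (∀ x, EvalDNF dnf x → EvalCNF cnf x) ∧
          (#((posGraphs m ⌈(m : ℝ) ^ (1 / 4 : ℝ)⌉₊).filter
              (fun x => φ.2 (fun j => decide (EvalCNF (C j) x)) = true ∧ ¬ EvalDNF dnf x)) : ℝ)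
            ≤ (1 / (8 * (m : ℝ) ^ (c + 1))) * #(posGraphs m ⌈(m : ℝ) ^ (1 / 4 : ℝ)⌉₊) ∧
          (#((((powersetCard (Fintype.card ((⊤ : SimpleGraph (Fin m)).edgeSet) / ⌊(m : ℝ) ^ (1 / 8 : ℝ)⌋₊)
          (univ : Finset ((⊤ : SimpleGraph (Fin m)).edgeSet))).image (fun M => fun e => decide (e ∉ M)))).filter
              (fun x => EvalCNF cnf x ∧ φ.2 (fun j => decide (EvalCNF (C j) x)) = false)) : ℝ)
            ≤ (1 / (8 * (m : ℝ) ^ (c + 1))) *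
              #(((powersetCard (Fintype.card ((⊤ : SimpleGraph (Fin m)).edgeSet) / ⌊(m : ℝ) ^ (1 / 8 : ℝ)⌋₊)
          (univ : Finset ((⊤ : SimpleGraph (Fin m)).edgeSet))).image (fun M => fun e => decide (e ∉ M))))) :=
  ConvPad.convCnfAll_of_convWideCnf  -- LANDED p157348 (c12 wave 2)

/-- REGISTERED SUB-GOAL `not_narrow_andPad` (lead c12, reshape r8; PROVED in the lead's `work/AndPad.lean`, to be landed):
the `∧`-padding of a gate `φ` that accepts something by `n' > T(log₂ T + 1)` dummy wires is neither PERM- nor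
GRANK-narrow at width `T` (every accepted pattern has all dummies on, against the landed minterm bound
`narrowAlgebraic_shortMinterms`). The padded gate is written inline (no definition):
`⟨φ.1 + n', v ↦ φ.2 (v ∘ Fin.castAdd n') && [∀ j, v (Fin.natAdd φ.1 j)]⟩`. [folklore] -/
theorem not_narrow_andPad : ∀ (T n' : ℕ) (φ : GateFn), (∃ v, φ.2 v = true) → T * (Nat.log 2 T + 1) < n' →
    ¬ (IsPermGate T ⟨φ.1 + n', fun v => φ.2 (fun i => v (Fin.castAdd n' i)) &&
        decide (∀ j : Fin n', v (Fin.natAdd φ.1 j) = true)⟩ ∨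
      IsGRankGate T ⟨φ.1 + n', fun v => φ.2 (fun i => v (Fin.castAdd n' i)) &&
        decide (∀ j : Fin n', v (Fin.natAdd φ.1 j) = true)⟩) :=
  AndPad.not_narrow_andPad  -- LANDED p156852 (c12)

/-- REGISTERED SUB-GOAL `isPermGate_andPad` (lead c12, wave 2; provable): the `∧`-padding of a PERM gate on `d ≤ s`
points by `n'` dummies is a PERM gate on `≤ s + 2n'` points — old generators act on the old points (identity on the
new ones), dummy `j` is the transposition of the two new points `2j, 2j+1`, the target is `τ` times the product of all
dummy transpositions; the closure of such a union is the direct product of the closures, and the product of the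
disjoint transpositions lies in the closure of a subfamily iff the subfamily is everything (a missing transposition's
points are fixed by all the others). [folklore] -/
theorem isPermGate_andPad : ∀ (s n' : ℕ) (φ : GateFn), IsPermGate s φ →
    IsPermGate (s + 2 * n') ⟨φ.1 + n', fun v => φ.2 (fun i => v (Fin.castAdd n' i)) &&
        decide (∀ j : Fin n', v (Fin.natAdd φ.1 j) = true)⟩ :=
  PermAndPad.isPermGate_andPad  -- LANDED p157342 (c12 wave 2)

/-- REGISTERED SUB-GOAL `isGRankGate_andPad` (lead c12, wave 2; provable): the `∧`-padding of a GRANK gate of dimension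
`d ≤ s` (pencil `K₀, K`, threshold `θ`, field `F`) by `n'` dummies is a GRANK gate of dimension `≤ s + (s+1)n'` over the
same field: block-diagonal pencil `diag(old pencil, X_{j} · I_{d+1} for each dummy j)`, threshold `θ + (d+1)n'`
(rank is additive over diagonal blocks; the old block has the old generic rank — a field extension does not change the
rank; a dummy off loses `d+1 > d ≥` any possible surplus of the old block). [folklore] -/
theorem isGRankGate_andPad : ∀ (s n' : ℕ) (φ : GateFn), IsGRankGate s φ →
    IsGRankGate (s + (s + 1) * n') ⟨φ.1 + n', fun v => φ.2 (fun i => v (Fin.castAdd n' i)) &&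
        decide (∀ j : Fin n', v (Fin.natAdd φ.1 j) = true)⟩ :=
  GRankAndPad.isGRankGate_andPad  -- LANDED p157500 (c12 wave 2)

end WaveTwo

/-! ## §1f (landed, lead c12 wave 4; imported since r8.1, lead c13) the r8 GRANK leaf in concrete `𝔽̄_p` form, no side condition:
`GRankPrimeFieldLeafAll.grankCnfAll_iff_primeFieldLeafAll` (p159564, `Theorems/…GRankPrimeFieldLeafAll.lean`; registered sub-goal,
closed) — `stub_grankCnfAll ↔ ∀ c, ∃ r₀ s₀, …, ∀ᶠ m, ∀ p prime, n, d ≤ m^c, θ, K₀ K over AlgebraicClosure (ZMod p), ∀ C …, the legal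
sandwich for the explicit gate ⟨n, v ↦ [θ ≤ rank (symbolicMatrix K₀ K v)]⟩`: the form in which a refuter picks ONE prime and ONE
pencil and in which the GRANK child of the r8 split may be filed. -/

/-- For the record (landed, c12 wave 4): the r8 GRANK leaf is equivalent to its concrete `𝔽̄_p` pencil form. -/
example := @GRankPrimeFieldLeafAll.grankCnfAll_iff_primeFieldLeafAll

/-! ## §1g Registered sub-goals of lead c13 (provable; wave 1): THE LOCALITY THRESHOLD MUST GROW WITH `c`

The `∀ c, ∃ r₀ s₀` order of the three leaves is LOAD-BEARING, and the engine's quadratic threshold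
`r₀(c) = Θ(c²)` is order-optimal: for `2 ≤ r ≤ C(j,2)` and `3j < 4(c+1)` the function "all `r` edges of a fixed pattern
`P ⊆ E(K_U)`, `#U = j`, are on" — ONE identity gate of each class reading ONE CNF of `r` unit clauses — accepts
`≥ C(m-j,k-j) > #P/(8m^{c+1})` bare cliques and rejects a fraction `≥ r/L - C(r,2)/L² - r/#E > (r-1)/L + 1/(8m^{c+1})` of the
negatives (`L = ⌊m^{1/8}⌋₊`), so by the dual horn `Horns.horns_of_pair` it admits NO legal `(r,s)`-local sandwich at level `c`
(strategist census S9/N8, target `LocalityMustGrow`, there on paper). Consequences (lead's assembly file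
`Theorems/…LocalityMustGrow.lean`): each r8 leaf body is FALSE at every `(c, r, s)` with `r ≤ C(⌈4(c+1)/3⌉ - 1, 2)`; the
uniform-locality strengthening `∃ r₀ s₀, ∀ c` of each leaf is FALSE; any admissible threshold has `r₀(c) > C(j,2)` whenever
`3j < 4(c+1)`. The five pieces below are registered so that stub-workers can land them `--supports`. -/

section LocalityMustGrow

open Classical

/-- REGISTERED SUB-GOAL `unitCnf_pos_count` (lead c13; provable): the POSITIVE COUNT. If `3j < 4(c+1)` then, for all large
`m`, for every vertex set `U` of size `j` and every edge pattern `P` inside `U`, the bare `⌈m^{1/4}⌉₊`-cliques with all of `P`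
on (⊇ the cliques on `Q ⊇ U`: `C(m-j, k-j)` of them, `cliqueVec` injective for `k ≥ 2`) are MORE than `#P/(8m^{c+1})`
(`C(m,k)·(k+1-j)^j ≤ C(m-j,k-j)·m^j` and `2^j m^{3j/4} < 8 m^{c+1} ` eventually, as `3j ≤ 4c+3`). [folklore] -/
theorem unitCnf_pos_count : ∀ c j : ℕ, 3 * j < 4 * (c + 1) → ∀ᶠ m : ℕ in atTop,
    ∀ U : Finset (Fin m), #U = j → ∀ P : Finset (EV m), (∀ e ∈ P, ∀ v ∈ (e : Sym2 (Fin m)), v ∈ U) →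
      (1 / (8 * (m : ℝ) ^ (c + 1))) * #(posGraphs m ⌈(m : ℝ) ^ (1 / 4 : ℝ)⌉₊) <
        #((posGraphs m ⌈(m : ℝ) ^ (1 / 4 : ℝ)⌉₊).filter fun x => ∀ e ∈ P, x e = true) :=
  UnitCnfPos.unitCnf_pos_count  -- LANDED p163210 (c13 wave 1)

/-- REGISTERED SUB-GOAL `unitCnf_neg_count` (lead c13; provable): the NEGATIVE COUNT. For `r ≥ 1` and all large `m`, for
every set `P` of `r` edge slots, the negatives of the referee pair (complements of the `t`-subsets `M` of the `#E` slots,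
`t = #E/⌊m^{1/8}⌋₊`) in which NOT all of `P` is on (i.e. `M ∩ P ≠ ∅`: `C(#E,t) - C(#E-r,t)` of them) are MORE than
`(1/(8m^{c+1}) + (r-1)/⌊m^{1/8}⌋₊)·#N` — the dual-horn threshold of `Horns.horns_of_pair`
(`C(#E-r,t)/C(#E,t) ≤ (1 - t/#E)^r ≤ 1 - r·u + C(r,2)·u²`, `u = t/#E ≥ 1/L - 1/#E`, and `1/(8m^{c+1}) + r/#E + C(r,2)/L² < 1/L`
eventually). [folklore] -/
theorem unitCnf_neg_count : ∀ c r : ℕ, 1 ≤ r → ∀ᶠ m : ℕ in atTop, ∀ P : Finset (EV m), #P = r →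
    (1 / (8 * (m : ℝ) ^ (c + 1)) + ((r - 1 : ℕ) : ℝ) / ⌊(m : ℝ) ^ (1 / 8 : ℝ)⌋₊) *
        #((powersetCard (Fintype.card (EV m) / ⌊(m : ℝ) ^ (1 / 8 : ℝ)⌋₊) (univ : Finset (EV m))).image
          (fun M => fun e => decide (e ∉ M))) <
      #(((powersetCard (Fintype.card (EV m) / ⌊(m : ℝ) ^ (1 / 8 : ℝ)⌋₊) (univ : Finset (EV m))).image
          (fun M => fun e => decide (e ∉ M))).filter fun x => ¬ ∀ e ∈ P, x e = true) :=
  UnitCnfNeg.unitCnf_neg_count  -- LANDED p163376 (c13 wave 1)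

/-- REGISTERED SUB-GOAL `exists_permGate_unitCnf` (lead c13; provable, small): the pattern function "all of `P` on" is ONE
PERM gate on `d ≥ 2` points reading ONE CNF of unit clauses — e.g. the identity gate `⟨1, v ↦ v 0⟩` (`σ 0 = τ = swap 0 1`
in `Sym (Fin 2)`, then `IsPermGate.mono`) with the single child `P.image ({·})` (clauses of size `1 ≤ s-1`). [folklore] -/
theorem exists_permGate_unitCnf : ∀ (m d s : ℕ), 2 ≤ d → 2 ≤ s → ∀ P : Finset (EV m),
    ∃ (φ : GateFn) (C : Fin φ.1 → Finset (Finset (EV m))), IsPermGate d φ ∧ #(univ.image C) ≤ 1 ∧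
      (∀ j, ∀ S ∈ C j, #S ≤ s - 1) ∧
      ∀ x : EV m → Bool, φ.2 (fun j => decide (EvalCNF (C j) x)) = decide (∀ e ∈ P, x e = true) :=
  UnitCnfPermGate.exists_permGate_unitCnf  -- LANDED p163060 (c13 wave 1)

/-- REGISTERED SUB-GOAL `exists_grankGate_unitCnf` (lead c13; provable, small): the same with ONE GRANK gate of dimension
`d ≥ 1` over any field — e.g. the identity gate as the `1 × 1` pencil `K₀ = 0`, `K 0 = 1`, `θ = 1` (rank of `(X₀)` is `1` iff
the wire is on; `symbolicMatrix`, `Matrix.rank` of a `1 × 1` matrix), child `P.image ({·})`. [folklore] -/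
theorem exists_grankGate_unitCnf : ∀ (m d s : ℕ), 1 ≤ d → 2 ≤ s → ∀ P : Finset (EV m),
    ∃ (φ : GateFn) (C : Fin φ.1 → Finset (Finset (EV m))), IsGRankGate d φ ∧ #(univ.image C) ≤ 1 ∧
      (∀ j, ∀ S ∈ C j, #S ≤ s - 1) ∧
      ∀ x : EV m → Bool, φ.2 (fun j => decide (EvalCNF (C j) x)) = decide (∀ e ∈ P, x e = true) :=
  UnitCnfGRankGate.exists_grankGate_unitCnf  -- LANDED p163140 (c13 wave 1)

/-- REGISTERED SUB-GOAL `exists_convGate_unitCnf` (lead c13; provable, small): the same with ONE CONV gate of width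
`d ≥ 1` — e.g. `GateFn.and 1` (`and_isConvGate 1 : IsConvGate 1 (GateFn.and 1)`, then `IsConvGate.mono`), child
`P.image ({·})`. [folklore] -/
theorem exists_convGate_unitCnf : ∀ (m d s : ℕ), 1 ≤ d → 2 ≤ s → ∀ P : Finset (EV m),
    ∃ (φ : GateFn) (C : Fin φ.1 → Finset (Finset (EV m))), IsConvGate d φ ∧ #(univ.image C) ≤ 1 ∧
      (∀ j, ∀ S ∈ C j, #S ≤ s - 1) ∧
      ∀ x : EV m → Bool, φ.2 (fun j => decide (EvalCNF (C j) x)) = decide (∀ e ∈ P, x e = true) :=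
  UnitCnfConvGate.exists_convGate_unitCnf  -- LANDED p162996 (c13 wave 1)

/-- REGISTERED SUB-GOAL `unitCnf_not_sandwichable` (lead c13; the assembled WITNESS, proof in the lead's
`work/LocalityMustGrow.lean`): for `2 ≤ r ≤ C(j,2)` and `3j < 4(c+1)`, eventually in `m`, the pattern function of `r` edge
slots inside a `j`-set admits NO legal `(r,s)`-local sandwich at level `c` on the referee pair (dual horn + the two counts). [folklore] -/
theorem unitCnf_not_sandwichable : ∀ c r s j : ℕ, 2 ≤ r → r ≤ j.choose 2 → 3 * j < 4 * (c + 1) →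
    ∀ᶠ m : ℕ in atTop, ∃ P : Finset (EV m), #P = r ∧
      (∃ U : Finset (Fin m), #U = j ∧ ∀ e ∈ P, ∀ v ∈ (e : Sym2 (Fin m)), v ∈ U) ∧
      ¬ ∃ dnf cnf : Finset (Finset (EV m)), (∀ R ∈ dnf, #R ≤ r - 1) ∧ (∀ S ∈ cnf, #S ≤ s - 1) ∧
        (∀ x, EvalDNF dnf x → EvalCNF cnf x) ∧
        (#((posGraphs m ⌈(m : ℝ) ^ (1 / 4 : ℝ)⌉₊).filter
            (fun x => decide (∀ e ∈ P, x e = true) = true ∧ ¬ EvalDNF dnf x)) : ℝ)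
          ≤ (1 / (8 * (m : ℝ) ^ (c + 1))) * #(posGraphs m ⌈(m : ℝ) ^ (1 / 4 : ℝ)⌉₊) ∧
        (#((((powersetCard (Fintype.card (EV m) / ⌊(m : ℝ) ^ (1 / 8 : ℝ)⌋₊)
          (univ : Finset (EV m))).image (fun M => fun e => decide (e ∉ M)))).filter
            (fun x => EvalCNF cnf x ∧ decide (∀ e ∈ P, x e = true) = false)) : ℝ)
          ≤ (1 / (8 * (m : ℝ) ^ (c + 1))) *
            #(((powersetCard (Fintype.card (EV m) / ⌊(m : ℝ) ^ (1 / 8 : ℝ)⌋₊)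
          (univ : Finset (EV m))).image (fun M => fun e => decide (e ∉ M)))) :=
  LocalityMustGrow.unitCnf_not_sandwichable  -- LANDED p163743 (c13)

/-- REGISTERED SUB-GOAL `permCnfAllAt_false` (lead c13; proof in `work/LocalityMustGrow.lean`): the r8 PERM leaf BODY (the text of
`stub_permCnfAll` after its quantifier prefix) is FALSE at every `(c, r, s)` with `2 ≤ r ≤ C(j,2)`, `3j < 4(c+1)`, `2 ≤ s` — so
`r₀(c) > C(⌈4(c+1)/3⌉ - 1, 2)` is forced and the uniform-locality strengthening `∃ r₀ s₀ ∀ c` is false. [folklore] -/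
theorem permCnfAllAt_false : ∀ c r s j : ℕ, 2 ≤ r → 2 ≤ s → r ≤ j.choose 2 → 3 * j < 4 * (c + 1) →
    ¬ (∀ᶠ m : ℕ in atTop, ∀ φ : GateFn, IsPermGate (m ^ c) φ →
      ∀ C : Fin φ.1 → Finset (Finset ((⊤ : SimpleGraph (Fin m)).edgeSet)),
        #(univ.image C) ≤ m ^ (c + 3) → (∀ j, ∀ S ∈ C j, #S ≤ s - 1) →
        ∃ dnf cnf : Finset (Finset ((⊤ : SimpleGraph (Fin m)).edgeSet)),
          (∀ R ∈ dnf, #R ≤ r - 1) ∧ (∀ S ∈ cnf, #S ≤ s - 1) ∧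
          (∀ x, EvalDNF dnf x → EvalCNF cnf x) ∧
          (#((posGraphs m ⌈(m : ℝ) ^ (1 / 4 : ℝ)⌉₊).filter
              (fun x => φ.2 (fun j => decide (EvalCNF (C j) x)) = true ∧ ¬ EvalDNF dnf x)) : ℝ)
            ≤ (1 / (8 * (m : ℝ) ^ (c + 1))) * #(posGraphs m ⌈(m : ℝ) ^ (1 / 4 : ℝ)⌉₊) ∧
          (#((((powersetCard (Fintype.card ((⊤ : SimpleGraph (Fin m)).edgeSet) / ⌊(m : ℝ) ^ (1 / 8 : ℝ)⌋₊)
          (univ : Finset ((⊤ : SimpleGraph (Fin m)).edgeSet))).image (fun M => fun e => decide (e ∉ M)))).filter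
              (fun x => EvalCNF cnf x ∧ φ.2 (fun j => decide (EvalCNF (C j) x)) = false)) : ℝ)
            ≤ (1 / (8 * (m : ℝ) ^ (c + 1))) *
              #(((powersetCard (Fintype.card ((⊤ : SimpleGraph (Fin m)).edgeSet) / ⌊(m : ℝ) ^ (1 / 8 : ℝ)⌋₊)
          (univ : Finset ((⊤ : SimpleGraph (Fin m)).edgeSet))).image (fun M => fun e => decide (e ∉ M))))) :=
  LocalityMustGrow.permCnfAllAt_false  -- LANDED p163743 (c13)

/-- REGISTERED SUB-GOAL `grankCnfAllAt_false` (lead c13): the same for the r8 GRANK leaf body. [folklore] -/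
theorem grankCnfAllAt_false : ∀ c r s j : ℕ, 2 ≤ r → 2 ≤ s → r ≤ j.choose 2 → 3 * j < 4 * (c + 1) →
    ¬ (∀ᶠ m : ℕ in atTop, ∀ φ : GateFn, IsGRankGate (m ^ c) φ →
      ∀ C : Fin φ.1 → Finset (Finset ((⊤ : SimpleGraph (Fin m)).edgeSet)),
        #(univ.image C) ≤ m ^ (c + 3) → (∀ j, ∀ S ∈ C j, #S ≤ s - 1) →
        ∃ dnf cnf : Finset (Finset ((⊤ : SimpleGraph (Fin m)).edgeSet)),
          (∀ R ∈ dnf, #R ≤ r - 1) ∧ (∀ S ∈ cnf, #S ≤ s - 1) ∧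
          (∀ x, EvalDNF dnf x → EvalCNF cnf x) ∧
          (#((posGraphs m ⌈(m : ℝ) ^ (1 / 4 : ℝ)⌉₊).filter
              (fun x => φ.2 (fun j => decide (EvalCNF (C j) x)) = true ∧ ¬ EvalDNF dnf x)) : ℝ)
            ≤ (1 / (8 * (m : ℝ) ^ (c + 1))) * #(posGraphs m ⌈(m : ℝ) ^ (1 / 4 : ℝ)⌉₊) ∧
          (#((((powersetCard (Fintype.card ((⊤ : SimpleGraph (Fin m)).edgeSet) / ⌊(m : ℝ) ^ (1 / 8 : ℝ)⌋₊)
          (univ : Finset ((⊤ : SimpleGraph (Fin m)).edgeSet))).image (fun M => fun e => decide (e ∉ M)))).filter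
              (fun x => EvalCNF cnf x ∧ φ.2 (fun j => decide (EvalCNF (C j) x)) = false)) : ℝ)
            ≤ (1 / (8 * (m : ℝ) ^ (c + 1))) *
              #(((powersetCard (Fintype.card ((⊤ : SimpleGraph (Fin m)).edgeSet) / ⌊(m : ℝ) ^ (1 / 8 : ℝ)⌋₊)
          (univ : Finset ((⊤ : SimpleGraph (Fin m)).edgeSet))).image (fun M => fun e => decide (e ∉ M))))) :=
  LocalityMustGrow.grankCnfAllAt_false  -- LANDED p163743 (c13)

/-- REGISTERED SUB-GOAL `convCnfAllAt_false` (lead c13): the same for the r8 CONV leaf body. [folklore] -/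
theorem convCnfAllAt_false : ∀ c r s j : ℕ, 2 ≤ r → 2 ≤ s → r ≤ j.choose 2 → 3 * j < 4 * (c + 1) →
    ¬ (∀ᶠ m : ℕ in atTop, ∀ φ : GateFn, IsConvGate (m ^ c) φ →
      ∀ C : Fin φ.1 → Finset (Finset ((⊤ : SimpleGraph (Fin m)).edgeSet)),
        #(univ.image C) ≤ m ^ (c + 3) → (∀ j, ∀ S ∈ C j, #S ≤ s - 1) →
        ∃ dnf cnf : Finset (Finset ((⊤ : SimpleGraph (Fin m)).edgeSet)),
          (∀ R ∈ dnf, #R ≤ r - 1) ∧ (∀ S ∈ cnf, #S ≤ s - 1) ∧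
          (∀ x, EvalDNF dnf x → EvalCNF cnf x) ∧
          (#((posGraphs m ⌈(m : ℝ) ^ (1 / 4 : ℝ)⌉₊).filter
              (fun x => φ.2 (fun j => decide (EvalCNF (C j) x)) = true ∧ ¬ EvalDNF dnf x)) : ℝ)
            ≤ (1 / (8 * (m : ℝ) ^ (c + 1))) * #(posGraphs m ⌈(m : ℝ) ^ (1 / 4 : ℝ)⌉₊) ∧
          (#((((powersetCard (Fintype.card ((⊤ : SimpleGraph (Fin m)).edgeSet) / ⌊(m : ℝ) ^ (1 / 8 : ℝ)⌋₊)
          (univ : Finset ((⊤ : SimpleGraph (Fin m)).edgeSet))).image (fun M => fun e => decide (e ∉ M)))).filter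
              (fun x => EvalCNF cnf x ∧ φ.2 (fun j => decide (EvalCNF (C j) x)) = false)) : ℝ)
            ≤ (1 / (8 * (m : ℝ) ^ (c + 1))) *
              #(((powersetCard (Fintype.card ((⊤ : SimpleGraph (Fin m)).edgeSet) / ⌊(m : ℝ) ^ (1 / 8 : ℝ)⌋₊)
          (univ : Finset ((⊤ : SimpleGraph (Fin m)).edgeSet))).image (fun M => fun e => decide (e ∉ M))))) :=
  LocalityMustGrow.convCnfAllAt_false  -- LANDED p163743 (c13)

/-- For the record (landed, c13): uniform locality is FALSE for each leaf, and admissible thresholds are quadratic in `c`. -/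
example := And.intro LocalityMustGrow.not_permCnfAll_uniform
  (And.intro LocalityMustGrow.not_grankCnfAll_uniform LocalityMustGrow.not_convCnfAll_uniform)

/-- (landed, c13) `r₀(c) > C(j,2)` whenever `3j < 4(c+1)`, for each leaf. -/
example := And.intro LocalityMustGrow.permCnfAll_threshold
  (And.intro LocalityMustGrow.grankCnfAll_threshold LocalityMustGrow.convCnfAll_threshold)

end LocalityMustGrow

/-! ## §2 Composition: the registered stubs close the crux BY NAME (landed r8 bridge `CnfSideR8.cliqueExtLowerBound_of_three_r8`, p158669: r8 ⇒ r7 trivially, then the landed r7 bridge) -/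

/-- **THE SKELETON (r8): the registered stubs prove the crux BY NAME** (real proof; the only `sorry`s of this file
are inside the three `stub_*All` declarations of §1; every sub-goal of §1b–§1d and the r8 bridge are landed). -/
theorem CliqueExtLowerBound_of : Summit.PneNP.PneNP.Theses.ConvexRankGates.CliqueExtLowerBound :=
  CnfSideR8.cliqueExtLowerBound_of_three_r8 stub_permCnfAll stub_grankCnfAll stub_convCnfAll

/-- For the record (landed, c12): the r8 leaves are EQUIVALENT to the r7 leaves (wideness is free). -/
example := And.intro CnfSideR8.permCnfAll_iff_permCnf
  (And.intro CnfSideR8.grankCnfAll_iff_grankCnf CnfSideR8.convCnfAll_iff_convWideCnf)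

/-- For the record (landed, c10): the horn brackets of the three stubs — the r7 texts imply one-sided
blindness with slack `(r-1)/⌊m^{1/8}⌋₊`, and one-sided blindness at the sharp threshold implies them. -/
example := And.intro HornsLeaves.hornSlack_of_permCnfText HornsLeaves.permCnfText_of_hornSharp

/-- (landed, c10) the GRANK bracket. -/
example := And.intro HornsLeaves.hornSlack_of_grankCnfText HornsLeaves.grankCnfText_of_hornSharp

/-- (landed, c10) the CONV bracket. -/
example := And.intro HornsLeaves.hornSlack_of_convWideCnfText HornsLeaves.convWideCnfText_of_hornSharp

/-- For the record (landed, unconditional): no poly-size circuit over `{∧₂,∨₂}` ∪ PERM/GRANK of width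
`≤ ⌊m^{1/16}⌋₊` ∪ real thresholds ∪ CONV with few rows / bounded psd dimension ∪ monotone gates of small
fan-in computes `CLIQUE(m, ⌈m^{1/4}⌉₊)` — `RealGateLowerBound.realGates_lowerBound` (p120634). -/
example : ∀ c : ℕ, ∀ᶠ m : ℕ in atTop, ∀ C : Circuit (EV m),
    C.IsOver (monotoneBasis ∪ {g | IsPermGate (TT m) g ∨ IsGRankGate (TT m) g}) →
      C.size ≤ m ^ c → ¬ C.Computes (cliqueFn m (kk m)) :=
  narrowLowerBound

end Summit.PneNP.PneNP.Cruxes.CliqueExtLowerBound.WidthThresholdCertificateSparsity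

end
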